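import Literature.NumberTheory.EllipticCurves.Kato2004.IwasawaCohomology
import Literature.NumberTheory.EllipticCurves.KatoDivisibilityIntegralSkeletonProofs
import Literature.NumberTheory.EllipticCurves.IwasawaAlgebraCharIdealProofs
import HarnessLib

/-!
# Kato 2004 (Astérisque 295), Thm. 12.4 (1), Thm. 12.5 (2)–(4), Thm. 12.6, Thm. 16.6, Prop. 17.11 and
# §17.13 (17.13.1)–(17.13.4) with p. 280: the INPUTS of Kato's §17.13 bookkeeping EXIST on the pinned
# Iwasawa cohomology `𝐇¹_Γ(T_pW)` (`IwasawaH1Data`) and the dual Selmer datum `X(E/ℚ_∞)`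
# (`SelmerDualData`) — ONE construction fact, shaped to feed `Kato2004.kato_divisibility_body_of_skeleton`

Topic `NumberTheory/EllipticCurves`, sub-directory `Kato2004`. Cell `bsd-smallim` (rung K6 of
`BirchSwinnertonDyer`, class X9), seat `bsd-smallim-k6-ty` (typer). HONEST FRAMING: one hypothesis
STRUCTURE (`DivisibilityInputs`, a package of abstract `Λ`-modules and maps whose fields are the
printed statements, nothing asserted), ONE named fact (`exists_divisibilityInputs`: the package is
inhabited — a CONSTRUCTION fact, D-0014), and THEOREMS: (i) the tree's named fact
`Literature.NumberTheory.EllipticCurves.kato_divisibility` (file `PAdicBSD`, = Thm. 17.4 for `T_pE`)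
FOLLOWS from `nonempty_iwasawaH1Data ∧ thm12_4 ∧ exists_divisibilityInputs` through the tree's
PROVED module theory of §17.13 (`Kato2004.kato_divisibility_body_of_skeleton`,
file `KatoDivisibilityIntegralSkeletonProofs`) — so the three construction/statement facts are a
discharge road for `kato_divisibility`, and conversely nothing here is stronger than what that road
needs plus the two printed clauses the cell's `μ`-argument consumes; (ii) the first step of the cell's
`μ`-transfer (HOME/koly/MU-TRANSFER-PROOF.md §6 (i)): "`μ(L_p(E)) = 0 ⟹` some integral zeta class is
not divisible by `p` in `𝐇¹`" (`exists_mem_zeta_not_mem_of_mu_eq_zero`). BSD is not advanced; the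
consumer's closes are rung-level and conditional on named facts.

## The printed statements (K. Kato, Astérisque 295 (2004); `[p. N]` printed page; store
`paper:doi-10-24033-ast-639`, PDF page `N − 115`; Thm. 12.4 and §§8.2, 12.2, 13.1 are quoted in
`IwasawaCohomology.lean`, (8.1.3)/Ex. 13.3 in `EulerSystemValues.lean`)

* **Thm. 12.4 (1) [p. 221]** "`𝐇²(T)` is a torsion `Λ`-module."  **(12.2.1) [p. 220]** "`𝐇¹(T)` and
  `𝐇²(T)` are finitely generated `ℤ_p[[G_∞]]`-modules."
* **Thm. 12.5 [pp. 221–222]** "(1) There exists a unique `F_λ`-linear map `V_{F_λ}(f) → 𝐇¹(V_{F_λ}(f));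
  γ ↦ z_γ^{(p)}` [characterised by its dual-exponential values `(2πi)^{k−r−1} L_{{p}}(f*, χ, r)·γ^±`]
  … (2) Let `Z(f)` be the `Λ ⊗ ℚ`-submodule of `𝐇¹(V_{F_λ}(f))` generated by `z_γ^{(p)}` for all
  `γ ∈ V_{F_λ}(f)`. Then `𝐇¹(V_{F_λ}(f))/Z(f)` is a torsion `Λ ⊗ ℚ`-module. (3) Let `𝔭` be a prime
  ideal of `Λ` of height one which does not contain `p`. Then
  `length_{Λ_𝔭}(𝐇²(V_{F_λ}(f))_𝔭) ≤ length_{Λ_𝔭}(𝐇¹(V_{F_λ}(f))_𝔭/Z(f)_𝔭) + length_{Λ_𝔭}(𝐇²_loc(V_{F_λ}(f))_𝔭)`.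
  If `𝐇²_loc(V_{F_λ}(f))_𝔭 ≠ 0`, then `f` and `𝔭` satisfy the following (12.5.1): `k = 2`, `f` is not
  potentially of good reduction at `p` (12.7), … (4) Let `T` be a `Gal(ℚ̄/ℚ)`-stable `O_λ`-lattice
  of `V_{F_λ}(f)`, and let `Z(f,T) ⊂ 𝐇¹(T) ⊗ ℚ` be the `Λ`-submodule of `𝐇¹(T) ⊗ ℚ` generated by
  `z_γ^{(p)}` for all `γ ∈ T`. Assume `p ≠ 2`, and assume that the following (12.5.2) is satisfied.
  (12.5.2) There exists an `O_λ`-basis of `T` for which the image of `Gal(ℚ̄/ℚ(ζ_{p^∞})) → GL₂(O_λ)`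
  contains `SL₂(ℤ_p)`. Then, `Z(f,T) ⊂ 𝐇¹(T)`. Furthermore,
  `length_{Λ_𝔭}(𝐇²(T)_𝔭) ≤ length_{Λ_𝔭}(𝐇¹(T)_𝔭/Z(f,T)_𝔭)` for any prime ideal of `Λ` of height one
  unless `f` and `𝔭` satisfy (12.5.1) in (3)."  Rem. 12.7 [pp. 222–223]: potentially good reduction
  holds "if `p` does not divide `N`".
* **Thm. 12.6 [p. 222]** "Let `T = V_{O_λ}(f)` (8.3). Let `Z` be the `Λ`-submodule of `𝐇¹(V_{O_λ}(f))`
  generated by the following elements (see (8.1.3), (8.11)). (1)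
  `(_{c,d}z^{(p)}_{p^n}(f, k, j, a(A), prime(pA)))_{n≥1} ∈ 𝐇¹(T)` (`1 ≤ j ≤ k−1`, `a, A ∈ ℤ`, `A ≥ 1`,
  `c, d ∈ ℤ`, `(c, 6pA) = (d, 6pN) = 1`). (2) `(_{c,d}z^{(p)}_{p^n}(f, k, j, α, prime(pN)))_{n≥1} ∈ 𝐇¹(T)`
  (`1 ≤ j ≤ k−1`, `α ∈ SL₂(ℤ)`, `c, d ∈ ℤ`, `(cd, 6pN) = 1`, `c ≡ d ≡ 1 mod N`). Then `Z ⊂ Z(f,T)` and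
  `Z(f,T)/Z` is a finite group."  (Proof §13.12 [pp. 231–233].)
* **Thm. 16.6 [p. 271]** "(2) For `η` as in (1), we have `L_{p-adic,α,ω,γ}(f) = 𝔏_η(z_γ^{(p)}(f*)(k))`
  where `ω` is regarded as an element of `D_dR(V_{F_λ}(f*))`" (`𝔏_η` = Perrin-Riou's map of Thm. 16.4).
* **Prop. 17.11 [p. 277]** "Assume `f` has good ordinary reduction at `λ`, let `T` be a
  `Gal(ℚ̄/ℚ)`-stable `O_λ`-lattice of `V_{F_λ}(f*)`, let `T' = T ∩ V'_{F_λ}(f*)`, `T'' = T/T' ⊂ V''_{F_λ}(f*)`.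
  Let `η` be a basis of the invertible `O_λ`-module … Then the homomorphism
  `𝔏_η : 𝐇¹_loc(T(k)) → … ` (16.4) induces an injection `𝐇¹_loc(T(k))/𝐇¹_loc(T'(k)) ↪ Λ`, whose
  cokernel is a finite group."
* **Thm. 17.4 (2), p. 279** "the property `L_{p-adic,α,ω,γ}(f) ∈ Λ ⊗ ℚ` (resp. `∈ Λ`) in 17.4 (2)
  (resp. 17.4 (3)) is known but follows also from 17.11 and 16.6 (resp. 17.11, 12.5 (4) and 16.6)."
* **§17.13 [pp. 279–280]** "(17.13.1) `0 → 𝐇¹(T(k))/(lim← H¹_f(ℤ[ζ_{p^n},1/p],T(r))(k−r)) →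
  𝐇¹_loc(T(k))/(lim← H¹_f(ℚ_p(ζ_{p^n}),T(r))(k−r)) → 𝔛(T*(1−k)) → 𝐇²(T(k)) → 𝐇²_loc(T(k))`
  (`T* = Hom_{O_λ}(T, O_λ)`) which is exact if `p ≠ 2`, and is exact upto `×2` in the case `p = 2`.
  We show first (17.13.2) `lim←_n H¹_f(ℤ[ζ_{p^n}, 1/p], T(r)) = 0`. … Next by 17.9, we have (17.13.3)
  `lim←_n H¹_f(ℚ_p(ζ_{p^n}), T(r))(k−r) ≅ 𝐇¹_loc(T'(k))` where `T' = T ∩ V'_{F_λ}(f*)`. Furthermore by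
  the latter half of Thm. 12.5 (3), (17.13.4) `𝐇²_loc(T(k))` is a finite group. … Let `𝔭` be a prime
  ideal of `Λ` of height one. In the case `𝔭` contains `p`, we assume `p ≠ 2` and that the condition
  (12.5.2) in 12.5 (4) is satisfied. By (17.13.2)–(17.13.4), we obtain from (17.13.1) an exact sequence
  `0 → 𝐇¹(T(k))_𝔭 → 𝐇¹_loc(T(k))_𝔭/𝐇¹_loc(T'(k))_𝔭 → 𝔛(T*(1−k))_𝔭 → 𝐇²(T(k))_𝔭 → 0`. Let `ω` … and
  `γ` … be good for `T`, in the sense of 17.5. By 17.11 and by 12.5, 16.6, we have an isomorphism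
  `𝐇¹_loc(T(k))_𝔭/𝐇¹_loc(T'(k))_𝔭 ≅ Λ_𝔭` which sends the image of `Z(f,T)(k)_𝔭` (12.5 (4)) onto
  `Λ_𝔭 · L_{p-adic,α,ω,γ}(f)`."  **17.5 [p. 274]** "In the case `f` of weight 2 and `T = (T_pE)(−1)`
  for an elliptic curve `E` over `ℚ`, `ω` is good for `T` if and only if `ω` is a `ℤ_p`-basis of
  `coLie(E) ⊗ ℤ_p` where `E` is the Néron model of `E`."

## The elliptic-curve specialisation (what the structure transcribes; conventions of the skeleton files)

`f = f_E` (`k = 2`, `F = ℚ`, `O_λ = ℤ_p`, `f* = f`), `T ≅ T_pE(−1)` (so `T(k) = T(2)`, `T*(1−k) ≅ T_pE(−1)`;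
the skeleton files' "`T = T_pE(-1)`"), `p ≠ 2` good ordinary. READING (module docstring of
`IwasawaCohomology.lean` and its component check): (17.13.1) is the `⟨1⟩`-twist of the Poitou–Tate
sequence of `T_pE` over `ℚ(ζ_{p^∞})`, and its `Δ`-trivial component is
`0 → 𝐇¹_Γ(T_pW) → P → X(E/ℚ_∞) → 𝐇²_Γ → 𝐇²_{Γ,loc}`, with `𝐇¹_Γ(T_pW) = I.H` for
`I : IwasawaH1Data W p κ γ`, `X(E/ℚ_∞) = D.X` for `D : W.SelmerDualData κ γ` (Kato's
`𝔛 = Hom(lim→ Sel(ℚ(ζ_{p^n}), T_pE)(−1), ℚ_p/ℤ_p)`, 17.2–17.3, on the `Δ`-trivial component), and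
`P = (𝐇¹_loc(T(k))/𝐇¹_loc(T'(k)))^{e₀}`, `H2 = 𝐇²_Γ`, `H2loc = 𝐇²_{Γ,loc}` ABSTRACT — exactly the roles
`H, P, X, H2, H2loc` of `KatoDivisibilitySkeletonProofs` (module docstring there), now with `H` and `X`
PINNED.  `Λ = IwasawaAlgebra p = ℤ_p⟦T⟧ = e₀·ℤ_p[[G_∞]]`; `L_p = padicLFunction f (unitRoot W p)` in
`T = γ_cyc − 1` (`IsCyclotomicVariable p γ`), `ι = iwasawaToPowerSeries p : Λ ↪ ℚ_p⟦T⟧`.  The clause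
"image of `Z` is `Λ_𝔭 · L`": Kato's `L = L_{p-adic,α,ω,γ}(f)` for `ω, γ` good FOR `T` (17.5: Néron
differential and Néron periods) is the Néron-normalised MTT function `L_E`, which differs from
`padicLFunction f α` (normalised by `Ω⁺_f`) by the factor `ϖ`, `ϖ·Ω_E = Ω⁺_f`, a `p`-adic UNIT when
`E[p]` is irreducible (Greenberg–Vatsal 2000 §3 (3.3); tree fact `realPeriodRat_eq_unit_mul_plusPeriod`)
— so the field `image_zeta_localized` below is stated under `W.HasIrreducibleModPGaloisRep p` and for
the IDEALS `Λ_𝔭·L` (insensitive to units and to the orientation `γ ↔ γ⁻¹` of the `Λ`-structure, by the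
functional equation of `L_p(E,T)`, MTT §I.17); under irreducibility all stable lattices are homothetic,
so `Z(f,T)` and `L` do not depend on the lattice either.  Where (12.5.2) enters: ONLY 12.5 (4)
(`Z(f,T) ⊂ 𝐇¹(T)` and the Euler-system inequality at `𝔭 ∋ p`) — field `integral`, under the
surjectivity hypothesis of `kato_divisibility` (3) which implies (12.5.2) (`det ρ = χ_cyc`); the
isomorphism sentence of p. 280 uses 17.11, 16.6 and 12.5 (1)(2) only (REF-KOLY-VERDICT v3 §2.4 of the
cell reads it the same way), so `image_zeta_localized` carries no image hypothesis beyond `Irr(E[p])`.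
`Z` (Thm. 12.6) ⊂ `𝐇¹(T)` unconditionally, with `Z(f,T)/Z` finite: at every height-one `𝔭`,
`Z_𝔭 = (Z(f,T) ∩ 𝐇¹)_𝔭`, so every localized clause printed for `Z(f,T)` holds for `Z`
(`es_bound`, `integral`, `image_zeta_localized`); and `p^m Z(f,T) ⊂ Z` for large `m`, whence the
element `G = p^n·L_p ∈ col(loc Z)` of `pow_mem` (16.6 (2) + 12.5 (1) + "`L ∈ Λ ⊗ ℚ`", p. 279).

## Why a package, what it pins, what it does NOT pin (read before use)

`𝐇²`, `𝐇²_loc` and `P` are not constructible in the tree (no degree-`2` corestriction, no Coleman map,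
no `D_dR`), so they are EXISTENTIAL inside `exists_divisibilityInputs`, constrained only by the printed
statements listed as fields; `I.H`, `D.X`, `Λ`, `L_p` are pinned.  Consequences: the fact is WEAKER than
print (it forgets which modules `P, 𝐇², 𝐇²_loc` are) and TRUE iff the genuine objects satisfy the
fields.  A consumer who states a further property of `𝐇²` "for every package" (e.g. the cell's
Theorem A, "`𝐳 ∉ p𝐇¹ ⟹ μ(𝐇²) = 0`") must check that the property is DETERMINED by the fields: by
exactness at `(p)`, `length_{(p)}(H2) = length_{(p)}(D.X) − length_{(p)}(P/loc I.H)` is determined as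
soon as the localized image of `Z` at `(p)` pins `col ∘ loc` up to a `(p)`-unit, which is the case
exactly when `Z ⊄ p·𝐇¹` (otherwise a package may rescale `col ∘ loc` by `p`); the cell's Theorem A
has precisely this hypothesis.  Nothing of the cell's memo is asserted here.

## What is NOT here

The definition of the zeta elements (§§2, 8: `EulerSystemValues.ZetaBody` carries their finite-level
Euler system), `exp*`, `D_dR`, Perrin-Riou's `𝔏_η` (Thm. 16.4), Selmer complexes; Thm. 12.5 (1) as a
value statement (its `Λ`-adic content enters only through 16.6 (2) = `pow_mem`/`image_zeta_localized`);
Conj. 12.10/17.6; `p = 2`; twists `ω^i`; weight `k > 2`; any proof of the fact.  No instance beyond the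
structure's own bundled fields; no notation.

## References

* K. Kato, Astérisque 295 (2004): Thm. 12.4 (p. 221), Thm. 12.5 (pp. 221–222), Thm. 12.6, Rem. 12.7
  (pp. 222–223), §13.12–13.14 (pp. 231–234), Thm. 16.4, Thm. 16.6 (pp. 270–271), Prop. 17.1–17.2,
  §17.3, Thm. 17.4, 17.5 (pp. 272–274), Prop. 17.11, Lemma 17.12, §17.13 (pp. 277–280) — read 2026-08-26
  from `paper:doi-10-24033-ast-639` pp. 106–119, 155–165. [Kato2004Asterisque]
* R. Greenberg, V. Vatsal, Invent. Math. 142 (2000), §3 Prop. (3.3), Prop. 3.7 (period ratio a `p`-unit,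
  `L_p ∈ Λ` under irreducibility). [GreenbergVatsal2000]
* B. Mazur, J. Tate, J. Teitelbaum, Invent. Math. 84 (1986), §I.17 (functional equation).
  [MazurTateTeitelbaum1986]
* Tree: `Kato2004/IwasawaCohomology.lean` (the pin `IwasawaH1Data`, `thm12_4`, `nonempty_iwasawaH1Data`),
  `KatoDivisibilitySkeletonProofs.lean` / `KatoDivisibilityIntegralSkeletonProofs.lean` (the proved
  bookkeeping this package feeds), `PAdicBSD.lean` (`kato_divisibility`), cell files
  HOME/koly/MU-TRANSFER-PROOF.md §6, REF-KOLY-VERDICT.md v3 §2.4.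
-/

noncomputable section

open scoped MatrixGroups ModularForm
open Field CongruenceSubgroup
open Literature.NumberTheory.GaloisRepresentations
open Literature.NumberTheory.EllipticCurves Literature.NumberTheory.EllipticCurves.ModularForms
open Literature.NumberTheory.EllipticCurves.Kato2004.EulerSystemValues

namespace Literature.NumberTheory.EllipticCurves.Kato2004

open Module

section Package

variable (W : WeierstrassCurve ℚ) [W.IsElliptic] [W.IsGloballyMinimal] (p : ℕ) [Fact p.Prime]
  [ContinuousSMul ℤ_[p] (W.tateModule p)] {N : ℕ} [NeZero N] (f : CuspForm (Gamma0 N) 2)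
  (κ : ZpExtension ℚ p) (γ : absoluteGaloisGroup ℚ)
  (I : IwasawaH1Data W p κ γ) (D : W.SelmerDualData κ γ)

/-- **Kato's §17.13 inputs on `(𝐇¹_Γ(T_pW), X(E/ℚ_∞))` — hypothesis structure (a package of the
printed statements; nothing asserted).**  For the pinned Iwasawa cohomology `I : IwasawaH1Data W p κ γ`
(`I.H = 𝐇¹_Γ(T_pW)`), a dual Selmer datum `D` (`D.X = X(E/ℚ_∞)`) and a newform `f` of `W`: abstract
`Λ`-modules `P` (`= 𝐇¹_loc(T(k))/𝐇¹_loc(T'(k))`, (17.13.3)), `H2` (`= 𝐇²`), `H2loc` (`= 𝐇²_loc`), the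
maps `loc : 𝐇¹ → P`, `toX : P → X`, `δ : X → 𝐇²`, `ε : 𝐇² → 𝐇²_loc` of (17.13.1), the Coleman map
`col : P ↪ Λ` of Prop. 17.11, the zeta submodule `Z ≤ 𝐇¹` of Thm. 12.6 and an element `G ∈ col(loc Z)`
with `ι G = p^n · L_p(E,T)`, subject to: (12.2.1) + Thm. 12.4 (1) (`H2` finitely generated torsion);
(17.13.1)+(17.13.2)+(17.13.3) for `p ≠ 2` (`loc` injective, exactness at `P`, `X`, `H2`); (17.13.4)
(`H2loc` finite); 17.11 (`col` injective with finite cokernel); 16.6 (2) with 12.5 (1)(2), 12.6 and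
p. 279 (`pow_mem`); Thm. 12.5 (3) at the height-one `𝔭 ∌ p` (`es_bound`, printed shape with the
`H2loc`-term); Thm. 12.5 (4) with 17.4 (3) under the surjectivity hypothesis of `kato_divisibility` (3)
(`integral`, verbatim the `hint` binder of `Kato2004.kato_divisibility_body_of_skeleton`); and the
p. 280 sentence "the image of `Z(f,T)_𝔭` is `Λ_𝔭 · L`" at EVERY height-one `𝔭`, under `Irr(E[p])`
(`image_zeta_localized`; module docstring for the normalisation and for why no (12.5.2) is attached).
The field list is exactly the hypothesis list of `Kato2004.kato_divisibility_body_of_skeleton` plus the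
two `μ`-relevant printed clauses (`finite_H2`, `image_zeta_localized`) and the fifth term of (17.13.1).
[cite: Kato2004Asterisque, Thm. 12.4 (1) (p. 221), Thm. 12.5 (2)–(4) (p. 222), Thm. 12.6 (p. 222), Thm. 16.6 (p. 271), Prop. 17.11 (p. 277), §17.13 (17.13.1)–(17.13.4) and p. 280 (pp. 279–280)] -/
structure DivisibilityInputs where
  /-- `P = 𝐇¹_loc(T(k))/𝐇¹_loc(T'(k))` ((17.13.3)), abstract. -/
  P : Type
  /-- `H2 = 𝐇²(T(k))` (`Δ`-trivial component), abstract. -/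
  H2 : Type
  /-- `H2loc = 𝐇²_loc(T(k))`, abstract. -/
  H2loc : Type
  [addCommGroupP : AddCommGroup P]
  [moduleP : _root_.Module (IwasawaAlgebra p) P]
  [addCommGroupH2 : AddCommGroup H2]
  [moduleH2 : _root_.Module (IwasawaAlgebra p) H2]
  [addCommGroupH2loc : AddCommGroup H2loc]
  [moduleH2loc : _root_.Module (IwasawaAlgebra p) H2loc]
  /-- (12.2.1): `𝐇²` is a finitely generated `Λ`-module. -/
  finite_H2 : Module.Finite (IwasawaAlgebra p) H2
  /-- Thm. 12.4 (1): `𝐇²` is a torsion `Λ`-module. -/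
  isTorsion_H2 : Module.IsTorsion (IwasawaAlgebra p) H2
  /-- (17.13.1): `𝐇¹ → P` (localisation at `p` followed by the quotient by `𝐇¹_loc(T')`). -/
  loc : I.H →ₗ[IwasawaAlgebra p] P
  /-- (17.13.1): `P → 𝔛 = X(E/ℚ_∞)`. -/
  toX : P →ₗ[IwasawaAlgebra p] D.X
  /-- (17.13.1): `𝔛 → 𝐇²`. -/
  δ : D.X →ₗ[IwasawaAlgebra p] H2
  /-- (17.13.1): `𝐇² → 𝐇²_loc`. -/
  ε : H2 →ₗ[IwasawaAlgebra p] H2loc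
  /-- (17.13.2) (`lim← H¹_f(ℤ[ζ_{p^n},1/p], T(r)) = 0`, p. 279): `𝐇¹ → P` is injective. -/
  loc_injective : Function.Injective loc
  /-- (17.13.1) with (17.13.3), `p ≠ 2`: exactness at `P`. -/
  exact_P : Function.Exact loc toX
  /-- (17.13.1), `p ≠ 2`: exactness at `𝔛`. -/
  exact_X : Function.Exact toX δ
  /-- (17.13.1), `p ≠ 2`: exactness at `𝐇²`. -/
  exact_H2 : Function.Exact δ ε
  /-- (17.13.4) (latter half of Thm. 12.5 (3); `f` potentially good at `p`): `𝐇²_loc` is finite. -/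
  finite_H2loc : Finite H2loc
  /-- Prop. 17.11: the Coleman map `𝔏_η` induces an injection `P ↪ Λ` … -/
  col : P →ₗ[IwasawaAlgebra p] IwasawaAlgebra p
  /-- Prop. 17.11: … which is injective … -/
  col_injective : Function.Injective col
  /-- Prop. 17.11: … with finite cokernel. -/
  finite_coker_col : Finite (IwasawaAlgebra p ⧸ LinearMap.range col)
  /-- Thm. 12.6: the `Λ`-span `Z ⊂ 𝐇¹(T)` of the integral zeta elements (8.1.3)/(8.11) (all admissible
  `c, d, j, a(A)` resp. `α`), projected to the `Δ`-trivial component. -/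
  Z : Submodule (IwasawaAlgebra p) I.H
  /-- The `p`-power denominator of 17.4 (2) "`L_{p-adic} ∈ Λ ⊗ ℚ`" (p. 279: from 17.11 and 16.6). -/
  n : ℕ
  /-- `G = p^n · L_p(E,T)` as an element of `Λ`. -/
  G : IwasawaAlgebra p
  /-- `ι G = p^n · L_p(E,T)` in `ℚ_p⟦T⟧` (17.4 (2), p. 279). -/
  ιG_eq : iwasawaToPowerSeries p G =
    PowerSeries.C ((p : ℚ_[p]) ^ n) * padicLFunction f (unitRoot W p : ℚ_[p])
  /-- Thm. 16.6 (2) with 12.5 (1) and 12.6 (`p^m Z(f,T) ⊂ Z`): `G ∈ col(loc Z)`. -/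
  pow_mem : G ∈ Submodule.map (col ∘ₗ loc) Z
  /-- Thm. 12.5 (3) (via Thm. 13.4 (2)) at the height-one primes `𝔭 ∌ p`, printed shape:
  `length 𝐇²_𝔭 ≤ length (𝐇¹/Z)_𝔭 + length (𝐇²_loc)_𝔭` (`Z(f)_𝔭 = Z_𝔭` there). -/
  es_bound : ∀ 𝔭 : PrimeSpectrum (IwasawaAlgebra p), 𝔭.asIdeal.height = 1 →
    PowerSeries.C (p : ℤ_[p]) ∉ 𝔭.asIdeal →
      lengthAt (IwasawaAlgebra p) H2 𝔭 ≤
        lengthAt (IwasawaAlgebra p) (I.H ⧸ Z) 𝔭 + lengthAt (IwasawaAlgebra p) H2loc 𝔭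
  /-- Thm. 12.5 (4) with 17.4 (3) (p. 279 "`L ∈ Λ`"), under the surjectivity hypothesis of
  `kato_divisibility` (3) (which implies (12.5.2); (12.5.1) excluded by good reduction): the integral
  zeta submodule `Z' = Z(f,T) ⊂ 𝐇¹` with `L_p = ι G' ∈ col(loc Z')` and the inequality at EVERY
  height-one prime — verbatim the `hint` binder of `Kato2004.kato_divisibility_body_of_skeleton`. -/
  integral : (∀ m : ℕ, W.HasSurjectiveModNGaloisRep (p ^ m : ℕ)) →
    ∃ (Z' : Submodule (IwasawaAlgebra p) I.H) (G' : IwasawaAlgebra p),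
      G' ∈ Submodule.map (col ∘ₗ loc) Z' ∧
      iwasawaToPowerSeries p G' = padicLFunction f (unitRoot W p : ℚ_[p]) ∧
      ∀ 𝔭 : PrimeSpectrum (IwasawaAlgebra p), 𝔭.asIdeal.height = 1 →
        lengthAt (IwasawaAlgebra p) H2 𝔭 ≤ lengthAt (IwasawaAlgebra p) (I.H ⧸ Z') 𝔭
  /-- p. 280 with 17.11, 16.6, 12.5 (1)(2), 12.6 and 17.5: under `Irr(E[p])`, for `G₁ ∈ Λ` with
  `ι G₁ = L_p(E,T)`, the submodules `col(loc Z)` and `Λ·G₁` of `Λ` agree after localisation at EVERY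
  height-one prime `𝔭` (`𝔭 ∋ p` included, `p ≠ 2`): some `s ∉ 𝔭` multiplies each into the other.
  Printed support for carrying no image hypothesis beyond `Irr(E[p])` here ((12.5.2) enters only
  through 12.5 (4) = field `integral`; module docstring): Skinner, Pacific J. Math. 283 (2016),
  §2.5, pp. 189–190 (bib key `Skinner2016PacificMC`) localises where (12.5.2) bites in the same way
  and notes it may be weakened to (a) `ρ̄` irreducible + (b) some `g ∈ G_{ℚ(μ_{p^∞})}` with
  `T/(ρ(g) − 1)T` free of rank one — a weakening NOT used by the tree (cell `bsd-cited` ARM P,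
  D-AUDIT-r01 §7 F2, 2026-08-26). -/
  image_zeta_localized : W.HasIrreducibleModPGaloisRep p → ∀ G₁ : IwasawaAlgebra p,
    iwasawaToPowerSeries p G₁ = padicLFunction f (unitRoot W p : ℚ_[p]) →
      ∀ 𝔭 : PrimeSpectrum (IwasawaAlgebra p), 𝔭.asIdeal.height = 1 →
        ∃ s : IwasawaAlgebra p, s ∉ 𝔭.asIdeal ∧
          s * G₁ ∈ Submodule.map (col ∘ₗ loc) Z ∧
          ∀ z ∈ Z, s * col (loc z) ∈ Ideal.span {G₁}

attribute [instance] DivisibilityInputs.addCommGroupP DivisibilityInputs.moduleP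
  DivisibilityInputs.addCommGroupH2 DivisibilityInputs.moduleH2
  DivisibilityInputs.addCommGroupH2loc DivisibilityInputs.moduleH2loc

end Package

/-! ## The named fact: the package exists (Kato's construction of §§12–17 for `f_E`) -/

/-- **Kato 2004, Thm. 12.4 (1), 12.5 (2)–(4), 12.6, 16.6, 17.11 and §17.13 for `T ≅ T_pE(−1)`, `k = 2`:
the §17.13 inputs EXIST on the pinned pair `(𝐇¹_Γ(T_pW), X(E/ℚ_∞))`.**  For every elliptic curve
`E/ℚ` with globally minimal model `W`, every ODD prime `p` of good ordinary reduction (`IsOrdinaryAt`,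
17.1), the cyclotomic `ℤ_p`-extension `κ` with topological generator `γ` matching the cyclotomic
variable, every newform `f` of `W`, every `I : IwasawaH1Data W p κ γ` and every `D : W.SelmerDualData κ γ`,
the structure `DivisibilityInputs W p f κ γ I D` is inhabited (by Kato's
`𝐇¹_loc(T(k))/𝐇¹_loc(T'(k))`, `𝐇²(T(k))`, `𝐇²_loc(T(k))`, the Poitou–Tate maps, `𝔏_η`, the span of the
integral zeta elements — `Δ`-trivial components; module docstring READING).  A CONSTRUCTION fact: its
content is that Kato's objects satisfy the listed printed statements; weaker than print (the identity
of `P, 𝐇², 𝐇²_loc` is forgotten), never stronger.  Named fact; nothing asserted; with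
`nonempty_iwasawaH1Data` and `thm12_4` it yields `kato_divisibility` (`kato_divisibility_of_inputs`).
[cite: Kato2004Asterisque, Thm. 12.4 (1) (p. 221), Thm. 12.5 (2)–(4) and Thm. 12.6 (p. 222), Thm. 16.6 (p. 271), Prop. 17.11 (p. 277), §17.13 (pp. 279–280)] -/
def exists_divisibilityInputs : Prop :=
  ∀ (W : WeierstrassCurve ℚ) [W.IsElliptic] [W.IsGloballyMinimal] (p : ℕ) [Fact p.Prime]
    [ContinuousSMul ℤ_[p] (W.tateModule p)] {N : ℕ} [NeZero N] (f : CuspForm (Gamma0 N) 2)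
    (κ : ZpExtension ℚ p) (γ : absoluteGaloisGroup ℚ),
    p ≠ 2 → IsOrdinaryAt W p → κ.IsCyclotomic → κ.IsTopGenerator γ → IsCyclotomicVariable p γ →
    IsNewformOf W f →
    ∀ (I : IwasawaH1Data W p κ γ) (D : W.SelmerDualData κ γ),
      Nonempty (DivisibilityInputs W p f κ γ I D)

/-! ## Theorems: a finite `Λ`-module dies at the height-one primes `𝔭 ∌ p`; `kato_divisibility` from
the three facts; the first step of the `μ`-transfer -/

section Consequences

variable {p : ℕ} [Fact p.Prime]

/-- A FINITE `Λ`-module `C` has `C_𝔭 = 0` (local length `0`) at every prime `𝔭 ∌ p`: `C` is killed by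
its order `#C = p^a·u`, `p ∤ u`, and `(p^a·u : Λ) = (C p)^a · C u` with `C u` a unit, so `#C ∉ 𝔭`
(`Module.lengthAt_eq_zero_of_isTorsionBy`).  Used to feed (17.13.4) into the `hH2loc` binder of the
skeleton theorems. [cite: Kato2004Asterisque, §17.13 (17.13.4) (p. 279)] -/
theorem lengthAt_eq_zero_of_finite_of_C_not_mem (C : Type*) [AddCommGroup C]
    [_root_.Module (IwasawaAlgebra p) C] [Finite C] (𝔭 : PrimeSpectrum (IwasawaAlgebra p))
    (hp𝔭 : PowerSeries.C (p : ℤ_[p]) ∉ 𝔭.asIdeal) : lengthAt (IwasawaAlgebra p) C 𝔭 = 0 := by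
  have hcard : 0 < Nat.card C := Nat.card_pos
  obtain ⟨a, u, hu, hN⟩ := Nat.exists_eq_pow_mul_and_not_dvd hcard.ne' p (Fact.out : p.Prime).ne_one
  refine Module.lengthAt_eq_zero_of_isTorsionBy (s := ((Nat.card C : ℕ) : IwasawaAlgebra p))
    (fun x ↦ ?_) 𝔭 ?_
  · rw [Nat.cast_smul_eq_nsmul, card_nsmul_eq_zero']
  · -- `#C = (C p)^a * C u` with `C u` a unit
    have hunit : IsUnit ((u : ℕ) : IwasawaAlgebra p) := by
      have hu' : IsUnit ((u : ℕ) : ℤ_[p]) := by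
        rw [PadicInt.isUnit_iff]
        refine le_antisymm (PadicInt.norm_le_one _) (not_lt.mp fun hlt ↦ hu ?_)
        have hdvd := (PadicInt.norm_int_lt_one_iff_dvd (p := p) (u : ℤ)).mp (by exact_mod_cast hlt)
        exact_mod_cast hdvd
      have := hu'.map (PowerSeries.C (R := ℤ_[p]))
      rwa [map_natCast] at this
    intro hmem
    rw [hN, Nat.cast_mul, Nat.cast_pow] at hmem
    have hCp : ((p : ℕ) : IwasawaAlgebra p) = PowerSeries.C (p : ℤ_[p]) := by
      rw [map_natCast]
    rw [hCp] at hmem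
    rcases 𝔭.isPrime.mem_or_mem hmem with h | h
    · exact hp𝔭 (𝔭.isPrime.mem_of_pow_mem _ h)
    · exact 𝔭.isPrime.ne_top (Ideal.eq_top_of_isUnit_mem _ h hunit)

/-- **`kato_divisibility` from Kato's inputs.**  The tree's named fact
`Literature.NumberTheory.EllipticCurves.kato_divisibility W p` (= Kato Thm. 17.4 (1)–(3) for `T_pE`,
file `PAdicBSD`) follows from the three statement/construction facts `nonempty_iwasawaH1Data`,
`thm12_4` (file `IwasawaCohomology`) and `exists_divisibilityInputs`, by the PROVED module theory of
§17.13 (`Kato2004.kato_divisibility_body_of_skeleton`): `H = I.H` is torsion free of rank `≤ 1`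
(Thm. 12.4 (2)), the package supplies `loc, toX, δ, col, Z, G` with their printed properties, and the
finite `𝐇²_loc` has length `0` at the `𝔭 ∌ p` (`lengthAt_eq_zero_of_finite_of_C_not_mem`).
[cite: Kato2004Asterisque, Thm. 17.4 (p. 273) and §17.13 (pp. 279–280)] -/
theorem kato_divisibility_of_inputs (hne : nonempty_iwasawaH1Data) (h12 : thm12_4)
    (hin : exists_divisibilityInputs) (W : WeierstrassCurve ℚ) [W.IsElliptic] [W.IsGloballyMinimal]
    (p : ℕ) [Fact p.Prime] [ContinuousSMul ℤ_[p] (W.tateModule p)] {κ : ZpExtension ℚ p}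
    {γ : absoluteGaloisGroup ℚ} {N : ℕ} [NeZero N] {f : CuspForm (Gamma0 N) 2} :
    kato_divisibility W p (κ := κ) (γ := γ) (f := f) := by
  intro hp hord hκ hγ hγ' hf D
  obtain ⟨I⟩ := hne W p κ γ hκ hγ
  obtain ⟨K⟩ := hin W p f κ γ hp hord hκ hγ hγ' hf I D
  obtain ⟨htf, hrank⟩ := h12.isTorsionFree_and_rank_le_one W p hκ hγ I
  haveI := htf
  haveI := K.finite_H2loc
  exact kato_divisibility_body_of_skeleton W p hord hf hκ hγ D hrank K.loc K.toX K.δ K.exact_P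
    K.exact_X K.col K.col_injective K.isTorsion_H2 K.Z K.pow_mem K.es_bound
    (fun 𝔭 _ hp𝔭 ↦ lengthAt_eq_zero_of_finite_of_C_not_mem K.H2loc 𝔭 hp𝔭) K.ιG_eq K.integral

variable {W : WeierstrassCurve ℚ} [W.IsElliptic] [W.IsGloballyMinimal]
  [ContinuousSMul ℤ_[p] (W.tateModule p)] {N : ℕ} [NeZero N] {f : CuspForm (Gamma0 N) 2}
  {κ : ZpExtension ℚ p} {γ : absoluteGaloisGroup ℚ}
  {I : IwasawaH1Data W p κ γ} {D : W.SelmerDualData κ γ}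

omit [NeZero N] in
/-- **First step of the cell's `μ`-transfer (HOME/koly/MU-TRANSFER-PROOF.md §6 (i); Kato p. 280 with
Thm. 12.6): if `E[p]` is irreducible and `L_p(E,T) = ι G₁` with `G₁ ∉ pΛ` (`μ(L_p(E)) = 0`: some
coefficient is a `p`-adic unit), then the zeta submodule `Z ⊂ 𝐇¹` is NOT contained in `p·𝐇¹`** — some
integral zeta class is indivisible by `p`.  Proof: at `𝔭 = (p)` (prime of height one,
`isPrime_augIdealP_holds`, `height_augIdealP_holds`) the package gives `s ∉ (p)` with
`s·G₁ ∈ col(loc Z)`; if `Z ⊆ p·𝐇¹` then `col(loc Z) ⊆ pΛ`, so `s·G₁ ∈ (p)` and, `(p)` being prime,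
`G₁ ∈ (p)` — contradiction.
[cite: Kato2004Asterisque, Thm. 12.6 (p. 222) and §17.13 (p. 280)] -/
theorem exists_mem_zeta_not_mem_of_mu_eq_zero (K : DivisibilityInputs W p f κ γ I D)
    (hirr : W.HasIrreducibleModPGaloisRep p) {G₁ : IwasawaAlgebra p}
    (hG₁ : iwasawaToPowerSeries p G₁ = padicLFunction f (unitRoot W p : ℚ_[p]))
    (hμ : G₁ ∉ IwasawaAlgebra.augIdealP p) :
    ∃ z ∈ K.Z, z ∉ IwasawaAlgebra.augIdealP p • (⊤ : Submodule (IwasawaAlgebra p) I.H) := by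
  let 𝔭 : PrimeSpectrum (IwasawaAlgebra p) :=
    ⟨IwasawaAlgebra.augIdealP p, IwasawaAlgebra.isPrime_augIdealP_holds p⟩
  obtain ⟨s, hs, hsG, -⟩ :=
    K.image_zeta_localized hirr G₁ hG₁ 𝔭 (by exact IwasawaAlgebra.height_augIdealP_holds p)
  by_contra hcon
  push Not at hcon
  -- `Z ≤ (p)•𝐇¹`, hence `col (loc Z) ⊆ (p)`
  have hZ : K.Z ≤ IwasawaAlgebra.augIdealP p • (⊤ : Submodule (IwasawaAlgebra p) I.H) :=
    fun z hz ↦ hcon z hz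
  have hsub : Submodule.map (K.col ∘ₗ K.loc) K.Z ≤
      (IwasawaAlgebra.augIdealP p • ⊤ : Submodule (IwasawaAlgebra p) (IwasawaAlgebra p)) :=
    (Submodule.map_mono hZ).trans (by rw [Submodule.map_smul'']; exact Submodule.smul_mono le_rfl le_top)
  have htop : (IwasawaAlgebra.augIdealP p • ⊤ : Submodule (IwasawaAlgebra p) (IwasawaAlgebra p)) =
      IwasawaAlgebra.augIdealP p := by
    rw [Ideal.smul_eq_mul, Ideal.mul_top]
  have hsG' : s * G₁ ∈ IwasawaAlgebra.augIdealP p := by rw [← htop]; exact hsub hsG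
  rcases (IwasawaAlgebra.isPrime_augIdealP_holds p).mem_or_mem hsG' with h | h
  · exact hs h
  · exact hμ h

/-- `μ(L_p(E)) = 0` in the certificate currency of the cell (`∃ n, ‖coeff_n L_p‖ = 1`, as in
`Rank1Residual.KatoMuTransfer`) means `G₁ ∉ (p)` for the integral element `G₁` with `ι G₁ = L_p`:
the `n`-th coefficient of `G₁` has norm `1`, hence is not divisible by `p` (dictionary lemma between the
certificate of `Rank1Residual.KatoMuTransfer` and `(p) ⊂ Λ`). [cite: Kato2004Asterisque, §17.13 (p. 280)] -/
theorem not_mem_augIdealP_of_norm_coeff_eq_one {G₁ : IwasawaAlgebra p} {L : PowerSeries ℚ_[p]}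
    (hG₁ : iwasawaToPowerSeries p G₁ = L) (hcert : ∃ n : ℕ, ‖PowerSeries.coeff n L‖ = 1) :
    G₁ ∉ IwasawaAlgebra.augIdealP p := by
  obtain ⟨n, hn⟩ := hcert
  intro hmem
  obtain ⟨c, hc⟩ := (IwasawaAlgebra.mem_augIdealP_iff p G₁).mp hmem n
  have hcoeff : PowerSeries.coeff n L = ((PowerSeries.coeff n G₁ : ℤ_[p]) : ℚ_[p]) := by
    rw [← hG₁, PowerSeries.coeff_map]; rfl
  rw [hcoeff, hc, PadicInt.coe_mul, norm_mul, PadicInt.coe_natCast, Padic.norm_p] at hn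
  have hle : ‖((c : ℤ_[p]) : ℚ_[p])‖ ≤ 1 := PadicInt.norm_le_one c
  have hp1 : (1 : ℝ) < p := by exact_mod_cast (Fact.out : p.Prime).one_lt
  have : (p : ℝ)⁻¹ * ‖((c : ℤ_[p]) : ℚ_[p])‖ < 1 := by
    calc (p : ℝ)⁻¹ * ‖((c : ℤ_[p]) : ℚ_[p])‖ ≤ (p : ℝ)⁻¹ * 1 := by gcongr
      _ < 1 := by rw [mul_one]; exact inv_lt_one_of_one_lt₀ hp1
  exact this.ne hn

end Consequences

end Literature.NumberTheory.EllipticCurves.Kato2004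

end
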